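/-
Copyright (c) 2026. All rights reserved.
Released under Apache 2.0 license as described in the file LICENSE.
Authors: HodgeCM publication cell (pub-hodgecm), GR lane, seat GR-1 (`pub-hodgecm-own-real34`).
-/
import Literature.NumberTheory.GelbartRogawski1991.DoubledWeilRepresentationArchTwistReal
import Literature.NumberTheory.GelbartRogawski1991.DoubledUnitaryArchSiegelSignRepsDiagonal
import Literature.NumberTheory.Automorphic.UnitaryGroupArchimedeanPlaces
import HarnessLib

/-!
# The archimedean twisting character is `1` at the pair sign representatives (diagonal Gram data)

Topic `NumberTheory/GelbartRogawski1991`; namespace `Literature.NumberTheory.GelbartRogawski1991.GRConstructionGen`.  KERNEL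
only: proved theorems; no definition, no named fact, no `sorry`.  Combines `DoubledWeilRepresentationArchTwistReal`
(`η = η₁ · archTwistR · archTwistC`, `η₁ = ∏_{κ₁} det(g_{w₁ k})^{m_k}`) with `DoubledUnitaryArchSiegelSignRepsDiagonal` (the
pair representative `q₀ k = mA (signPatternGL (mulSingle w_k ε · mulSingle (c⁻¹w_k) ε))`, `ε = diag dε`, `dε i² = 1`, has complex
coordinates `1` and real coordinates symmetric sign diagonals): each of the three factors is `1` at `q₀ k`
(`archTwistC`: `det_w = det 1`; `archTwistR`: `det (q₀ k)_{w_j} = (∏ dε)² = 1` or `1`; `η₁`: `g_{w₁ k'} = 1`), whence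
**`archTwist_pair_eq_one : η (q₀ k) = 1`** — with `chiDet (q₀ k) = 1`, `modDelta (q₀ k) = 1`
(`DoubledUnitaryArchSiegelSignRepsValues`) this is the scalar identity `η(q₀ k) = χ(det_Δ)|det_Δ|^{1/2}` of the `hval₀` binder of
`DoubledWeilRepresentationArchLiftSigns.exists_isArchHalf_twist_prod_signs` at the pair representatives.
([GelbartRogawski1991, Prop. 3.1.1], type (ii); [Kudla1994, §3].)  Written for the stage-1 cell `pub-hodgecm` (seat GR-1);
nothing here is a claim of the manuscripts adjudicated by that cell.

## References

* S. Gelbart, J. Rogawski, Invent. Math. 105 (1991), §3.1 Prop. 3.1.1 p. 455 [GelbartRogawski1991].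
* S. S. Kudla, Israel J. Math. 87 (1994), §3 [Kudla1994].
-/

set_option autoImplicit false

noncomputable section

open scoped Classical ComplexConjugate MatrixGroups
open scoped Matrix
open NumberField NumberField.InfinitePlace NumberField.mixedEmbedding IsDedekindDomain
open Literature.NumberTheory.Automorphic Literature.NumberTheory.Automorphic.UnitaryGroup
open Literature.NumberTheory.Weil1964
open Literature.NumberTheory.GaloisRepresentations
open Literature.RepresentationTheory.HeisenbergGroup
open Literature.NumberTheory.GelbartRogawski1991.UnitaryDualPair.ArchSplitting
open Literature.NumberTheory.GelbartRogawski1991.UnitaryDualPair.ArchSplitting.QuadExt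

namespace Literature.NumberTheory.GelbartRogawski1991.GRConstructionGen

open UnitaryDualPair

variable (F : Type) [Field F] [NumberField F] (E : Type) [Field E] [NumberField E] [Algebra F E]
  [Algebra.IsQuadraticExtension F E]
variable (c : E ≃ₐ[F] E) {δ : E} (hcδ : c δ = -δ) (hδ : δ ≠ 0)
variable {N M n : ℕ} (e : Fin N × Fin M ≃ Fin n) (dV : Fin N → F) (dW : Fin M → F)
  (hdV : IsUnit (Matrix.diagonal dV).det) (hdW : IsUnit (Matrix.diagonal dW).det)
variable (mA : GL (Fin n) (mixedSpace E) →* arch F E c (n + n) (hermD F E e (Matrix.diagonal dV) (Matrix.diagonal dW)))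
  (h2 : ∀ r, (2 : mixedSpace E) • Matrix.reindex (e₂ (n := n)).symm (e₂ (n := n)).symm
        (((mA r : arch F E c (n + n) (hermD F E e (Matrix.diagonal dV) (Matrix.diagonal dW))) : GL (Fin (n + n)) (mixedSpace E)) :
          Matrix (Fin (n + n)) (Fin (n + n)) (mixedSpace E)) =
      Matrix.fromBlocks (1 : Matrix (Fin n) (Fin n) (mixedSpace E)) 1 1 (-1) *
        Matrix.fromBlocks (r : Matrix (Fin n) (Fin n) (mixedSpace E)) 0 0
          ((((gramR F e (Matrix.diagonal dV) (Matrix.diagonal dW)).map (algebraMap F E)).map (mixedEmbedding E) +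
              ((gramR F e (Matrix.diagonal dV) (Matrix.diagonal dW)).map (algebraMap F E)).map (mixedEmbedding E))⁻¹ *
            (((r⁻¹ : GL (Fin n) (mixedSpace E)) : Matrix (Fin n) (Fin n) (mixedSpace E)).map (conjMixed F E c))ᵀ *
            (((gramR F e (Matrix.diagonal dV) (Matrix.diagonal dW)).map (algebraMap F E)).map (mixedEmbedding E) +
              ((gramR F e (Matrix.diagonal dV) (Matrix.diagonal dW)).map (algebraMap F E)).map (mixedEmbedding E))) *
        Matrix.fromBlocks (1 : Matrix (Fin n) (Fin n) (mixedSpace E)) 1 1 (-1))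
variable {κ : Type*} [Fintype κ] (wOf : κ → {w : InfinitePlace E // w.IsReal}) (eκ : κ ⊕ κ ≃ {w : InfinitePlace E // w.IsReal})
  (he₁ : ∀ k, eκ (Sum.inl k) = wOf k) (he₂ : ∀ k, eκ (Sum.inr k) = ⟨c⁻¹ • (wOf k).1, isReal_smul_iff.mpr (wOf k).2⟩)
  (ε : GL (Fin n) ℝ) (dε : Fin n → ℝ) (hεd : ((ε : GL (Fin n) ℝ) : Matrix (Fin n) (Fin n) ℝ) = Matrix.diagonal dε)
  (hdε : ∀ i, dε i * dε i = 1)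

omit [NumberField F] [NumberField E] [Algebra.IsQuadraticExtension F E] [Fintype κ] in
include h2 hdV hdW he₁ he₂ hεd hdε in
/-- the place component `archAt w (q₀ k) = 1` at every `c`-fixed complex place `w`. [cite: Kudla1994, §3] -/
theorem archAt_pair_eq_one (hcc : c * c = 1) (hc : c ≠ 1) (w : {w : InfinitePlace E // w.IsComplex}) (hw : c • w.1 = w.1) (k : κ) :
    ((archAt F E c (n + n) (hermD F E e (Matrix.diagonal dV) (Matrix.diagonal dW)) w hw hc
        (mA (signPatternGL E (Pi.mulSingle (wOf k) ε *
          Pi.mulSingle (⟨c⁻¹ • (wOf k).1, isReal_smul_iff.mpr (wOf k).2⟩ : {w : InfinitePlace E // w.IsReal}) ε))) :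
        archLocal E (n + n) (hermD F E e (Matrix.diagonal dV) (Matrix.diagonal dW)) w) : GL (Fin (n + n)) ℂ) = 1 := by
  apply Units.ext
  have h := map_evalC_leviCayley_pair F E c e dV dW wOf eκ he₁ he₂ hcc hdV hdW mA h2 ε dε hεd hdε k w
  refine Matrix.ext fun i j => ?_
  rw [coe_archAt_apply, Units.val_one]
  exact (congrFun (congrFun h i) j)

omit [NumberField F] [NumberField E] [Algebra.IsQuadraticExtension F E] [Fintype κ] in
include h2 hdV hdW he₁ he₂ hεd hdε in
/-- `det (q₀ k)_{w_j} = 1` (a symmetric sign diagonal: `(∏ dε)² = 1`). [cite: Kudla1994, §3] -/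
theorem det_map_evalR_pair_eq_one (hcc : c * c = 1) (k j : κ) :
    ((((mA (signPatternGL E (Pi.mulSingle (wOf k) ε *
        Pi.mulSingle (⟨c⁻¹ • (wOf k).1, isReal_smul_iff.mpr (wOf k).2⟩ : {w : InfinitePlace E // w.IsReal}) ε)) :
          arch F E c (n + n) (hermD F E e (Matrix.diagonal dV) (Matrix.diagonal dW))) : GL (Fin (n + n)) (mixedSpace E)) :
          Matrix (Fin (n + n)) (Fin (n + n)) (mixedSpace E)).map (evalR E (wOf j))).det = 1 := by
  rw [map_evalR_leviCayley_pair F E c e dV dW wOf eκ he₁ he₂ hcc hdV hdW mA h2 ε dε hεd hdε k j, Matrix.det_diagonal,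
    ← Fintype.prod_equiv (e₂ (n := n)) (fun x => Sum.elim (if j = k then dε else fun _ => 1) (if j = k then dε else fun _ => 1) x)
      _ (fun x => by rw [Equiv.symm_apply_apply]), Fintype.prod_sum_type]
  simp only [Sum.elim_inl, Sum.elim_inr, ← Finset.prod_mul_distrib]
  refine Finset.prod_eq_one fun i _ => ?_
  by_cases h : j = k
  · rw [if_pos h]; exact hdε i
  · rw [if_neg h]; exact one_mul 1

omit [Algebra.IsQuadraticExtension F E] in
include h2 hdV hdW he₁ he₂ hεd hdε in
/-- **`η (q₀ k) = 1`**: the twisting character `η = η₁ · archTwistR · archTwistC` (`η₁ = ∏_{κ₁} det(g_{w₁ k})^{m_k}`) is trivial at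
every pair sign representative `q₀ k` (diagonal Gram data, diagonal sign `ε`). [cite: GelbartRogawski1991, §3.1 Prop. 3.1.1 p. 455]
[cite: Kudla1994, §3] -/
theorem archTwist_pair_eq_one (hcc : c * c = 1) (hc : c ≠ 1) (χ : HeckeCharacter E)
    {κ₁ : Type*} [Fintype κ₁] (w₁ : κ₁ → {w : InfinitePlace E // w.IsComplex}) (hw₁ : ∀ k, c • (w₁ k).1 = (w₁ k).1) (m : κ₁ → ℤ)
    (η₁ : arch F E c (n + n) (hermD F E e (Matrix.diagonal dV) (Matrix.diagonal dW)) →* ℂˣ)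
    (hη₁ : ∀ g, ((η₁ g : ℂˣ) : ℂ) =
      ∏ k : κ₁, ((((archAt F E c (n + n) (hermD F E e (Matrix.diagonal dV) (Matrix.diagonal dW)) (w₁ k) (hw₁ k) hc g :
        archLocal E (n + n) (hermD F E e (Matrix.diagonal dV) (Matrix.diagonal dW)) (w₁ k)) : GL (Fin (n + n)) ℂ) :
          Matrix (Fin (n + n)) (Fin (n + n)) ℂ).det) ^ m k)
    (wC : {v : InfinitePlace F // v.IsComplex} → {w : InfinitePlace E // w.IsComplex}) (k : κ) :
    (((η₁ * archTwistR F E c e (Matrix.diagonal dV) (Matrix.diagonal dW) wOf χ *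
        archTwistC F E c e (Matrix.diagonal dV) (Matrix.diagonal dW) χ wC)
      (mA (signPatternGL E (Pi.mulSingle (wOf k) ε *
        Pi.mulSingle (⟨c⁻¹ • (wOf k).1, isReal_smul_iff.mpr (wOf k).2⟩ : {w : InfinitePlace E // w.IsReal}) ε))) : ℂˣ) : ℂ) = 1 := by
  set q := mA (signPatternGL E (Pi.mulSingle (wOf k) ε *
    Pi.mulSingle (⟨c⁻¹ • (wOf k).1, isReal_smul_iff.mpr (wOf k).2⟩ : {w : InfinitePlace E // w.IsReal}) ε)) with hq
  -- `η₁ q = 1`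
  have h1 : ((η₁ q : ℂˣ) : ℂ) = 1 := by
    rw [hη₁]
    refine Finset.prod_eq_one fun k' _ => ?_
    rw [hq, archAt_pair_eq_one F E c e dV dW hdV hdW mA h2 wOf eκ he₁ he₂ ε dε hεd hdε hcc hc (w₁ k') (hw₁ k') k,
      Units.val_one, Matrix.det_one, _root_.one_zpow]
  -- `archTwistR q = 1`
  have h2' : ((archTwistR F E c e (Matrix.diagonal dV) (Matrix.diagonal dW) wOf χ q : ℂˣ) : ℂ) = 1 := by
    rw [archTwistR_apply, Units.coe_prod]
    refine Finset.prod_eq_one fun j _ => ?_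
    have hunit : Units.map (evalR E (wOf j) : mixedSpace E →+* ℝ).toMonoidHom
        (Matrix.GeneralLinearGroup.det (q : GL (Fin (n + n)) (mixedSpace E))) = 1 := by
      apply Units.ext
      rw [Units.coe_map, RingHom.toMonoidHom_eq_coe, MonoidHom.coe_coe, Matrix.GeneralLinearGroup.val_det_apply, RingHom.map_det,
        RingHom.mapMatrix_apply, Units.val_one, hq]
      exact det_map_evalR_pair_eq_one F E c e dV dW hdV hdW mA h2 wOf eκ he₁ he₂ ε dε hεd hdε hcc k j
    rw [hunit, map_one, Units.val_one]
  -- `archTwistC q = 1`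
  have h3 : ((archTwistC F E c e (Matrix.diagonal dV) (Matrix.diagonal dW) χ wC q : ℂˣ) : ℂ) = 1 := by
    rw [archTwistC_apply, Units.coe_prod]
    refine Finset.prod_eq_one fun v _ => ?_
    have hunit : detAtC F E c (hermD F E e (Matrix.diagonal dV) (Matrix.diagonal dW)) (wC v) q = 1 := by
      apply Units.ext
      rw [coe_detAtC, Units.val_one, hq, map_evalC_leviCayley_pair F E c e dV dW wOf eκ he₁ he₂ hcc hdV hdW mA h2 ε dε hεd hdε k (wC v),
        Matrix.det_one]
    rw [hunit, map_one, Units.val_one]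
  rw [MonoidHom.mul_apply, MonoidHom.mul_apply, Units.val_mul, Units.val_mul, h1, h2', h3, one_mul, one_mul]

end Literature.NumberTheory.GelbartRogawski1991.GRConstructionGen

end
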